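import Summits.BirchSwinnertonDyer.BirchSwinnertonDyer.Theorems.TwinTransportX9Rung648a1

/-!
# Route `TwinTransportX9` — SECOND witness rung of the deciding crux `TrivialTwinSupplyX9` (item 24080) at the
# pair `(9225a1, p = 7)`, frame `(d_K, d_F) = (-59, 181)`, twin `W₁ = 9225a1^(-59) = [0,0,1,8980980,-112820075899]`

A second DECIDED INSTANCE of the crux body, in a second mod-`p` IMAGE CLASS: rung #1
(`TwinTransportX9Rung648a1`, pair `(648a1, 5)`) has exceptional image `5S4`; `9225a1 = [0,0,1,2580,549326]`
(`N = 9225 = 3²·5²·41`, `a_7 = 2`, `∏ c_ℓ = 2`, `#tors = 1`, `r_an = 1`) carries the image label `7Ns`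
(normaliser of a split Cartan) in the X9 cell census (`Rank1Residual/X9/PrintCertHeegnerCertsX9Ns`,
`heegnerCertsNs7[0]`), which is the judge's named key risk for this crux ("small-image congruences").
HONEST FRAMING: BSD is NOT proved and nothing is claimed about `TrivialTwinSupplyX9` in general (named open
in print, Prasanna 2010 p. 400); the X9 image hypotheses (`ClassX9 W 7`) are HYPOTHESES of the instance.
Displayed binders, exactly as in rung #1: the two PUBLISHED named facts `kolyvagin 9225 W K` (Kolyvagin 1990
Thm. A) and `MatarNekovar2019.thm03_padicValNat_card_sha_le_of_irreducible 9225 W K` (Matar–Nekovář 2019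
Thm. 0.3, no surjectivity needed), and the ENGINE data of the pair — `r_an(W₁) = 0`, `L(W₁,1)/Ω(W₁) = 4`, the
Heegner point `y_K ∈ E(K)`, `K = ℚ(√-59)`, of infinite order with `7 ∤ [E(K) : ℤ y_K]` (`y_K = -2·g`,
`g = (-6, 730)`, `#E(K)_tors = 1`; hash-first preregistered kit PARI job j298937, VERDICT PASS C1–C7; cell
certificate `heegnerCertsNs7[0]`, kit j288543 / j287411; memo `Cruxes/TrivialTwinSupplyX9/Lines/rung_9225a1_7.md`).
DECIDED IN THE KERNEL: ellipticity and global minimality of both equations (Kraus), the twin identity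
`⟨1,0,0,-1/2⟩ • W₁ = 9225a1^(-59)` ON THE NOSE, the primes of `N(9225a1)` are `3, 5, 41`, BCS-admissibility of
`(-59, 181)` at `7`, the Heegner hypothesis of `ℚ(√-59)` for `9225`, `7 ∤ #W₁(ℚ)_tors` (irreducibility travels
with the twist), `ord_7 ∏ c_ℓ(W₁) = ord_7 ∏ c_ℓ(9225a1)` (Jetchev–Skinner–Wan (eq:tamK)), and the transport
`Ш(9225a1/K)[7] = 0 ⟹ Ш(W₁/ℚ)[7] = 0` (rung #1's `shaFinite_and_not_dvd_shaOrder_twist_of_mn03` applied to the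
raw twist, then `#Ш` is invariant under the change of variables to the minimal twin). NOT rechecked in the
kernel: `L`-values, periods, heights, the index. WITNESS OF WEAKNESS (T3): `N(W₁) = 32112225 > 5000` and the
mod-`7` image of `W₁` is that of `9225a1` twisted by a character (not surjective), so `BSD₇(W₁)` lies outside
every verified regime in the tree (Miller 2011 / Creutz–Miller `N < 5000`; BCS 2025 Thm. 1.1.2 (b) needs
(sur)/(im)), while the instance holds with `¬ 7 ∣ #Ш(W₁)` UNCONDITIONAL.

References: Matar–Nekovář 2019 Thm. 0.3 [MatarNekovar2019]; Kolyvagin 1990 Thm. A [KolyvaginEulerSystems1990];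
Gross 1991 §1–§2 [GrossLMS1991]; Jetchev–Skinner–Wan 2017 §7.3.1 [JetchevSkinnerWan2017]; Burungale–Castella–Skinner
2025 §1.2, Prop. 5.2.1 [BurungaleCastellaSkinner2025]; Prasanna 2010 p. 400 [Prasanna2010]; Silverman AEC VII.1,
VIII.8, X.5 [SilvermanAEC2009]; Cremona's database [Cremona2006].
-/

set_option linter.dupNamespace false
set_option autoImplicit false

noncomputable section

open scoped Classical NumberField

open WeierstrassCurve Literature.NumberTheory.EllipticCurves
  Literature.NumberTheory.EllipticCurves.Rank1Residual.X11RankOneCertificates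
  Summit.BirchSwinnertonDyer.Rank1Residual.X11b
  Summit.BirchSwinnertonDyer.BirchSwinnertonDyer.Rank1Residual.IntModel
  Summit.BirchSwinnertonDyer.BirchSwinnertonDyer.Rank1Residual
  Summit.BirchSwinnertonDyer.BirchSwinnertonDyer.Theses.TwinTransportX9

namespace Summit.BirchSwinnertonDyer.BirchSwinnertonDyer.Theorems.TwinTransportX9Rung

/-! ## §1 The pair `9225a1`, its twin `W₁ = 9225a1^(-59)`, minimality, the twin identity -/

/-- `9225a1` is an elliptic curve (`Δ = -3³·5²·41⁷ ≠ 0`). [cite: Cremona2006, §3 (label 9225a1)] -/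
theorem isElliptic_9225a1 : (⟨0, 0, 1, 2580, 549326⟩ : WeierstrassCurve ℚ).IsElliptic :=
  isElliptic_of_discOf_ne_zero 0 0 1 2580 549326 (by decide +kernel)

/-- `W₁` is an elliptic curve (`Δ = -3³·5²·41⁷·59⁶ ≠ 0`). [cite: SilvermanAEC2009, III.1] -/
theorem isElliptic_9225a1d59 : (⟨0, 0, 1, 8980980, -112820075899⟩ : WeierstrassCurve ℚ).IsElliptic :=
  isElliptic_of_discOf_ne_zero 0 0 1 8980980 (-112820075899) (by decide +kernel)

/-- `9225a1` is GLOBALLY MINIMAL (`|Δ| = 3³·5²·41⁷`, no `q¹² ∣ Δ`). [cite: SilvermanAEC2009, VII.1 Remark 1.1] [cite: Kraus1989, Prop. 1 and Prop. 2] -/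
theorem isGloballyMinimal_9225a1 : (⟨0, 0, 1, 2580, 549326⟩ : WeierstrassCurve ℚ).IsGloballyMinimal :=
  isGloballyMinimal_of_krausCriterion_support 0 0 1 2580 549326
    [(3, 2, 3), (5, 2, 2), (41, 1, 7)] (by intro t ht; fin_cases ht <;> norm_num) (by decide +kernel) (by decide +kernel)

/-- `W₁` is GLOBALLY MINIMAL (`|Δ| = 3³·5²·41⁷·59⁶`, no `q¹² ∣ Δ`). [cite: SilvermanAEC2009, VII.1 Remark 1.1] [cite: Kraus1989, Prop. 1 and Prop. 2] -/
theorem isGloballyMinimal_9225a1d59 : (⟨0, 0, 1, 8980980, -112820075899⟩ : WeierstrassCurve ℚ).IsGloballyMinimal :=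
  isGloballyMinimal_of_krausCriterion_support 0 0 1 8980980 (-112820075899)
    [(3, 2, 3), (5, 2, 2), (41, 1, 7), (59, 2, 6)] (by intro t ht; fin_cases ht <;> norm_num) (by decide +kernel) (by decide +kernel)

/-- The integral model of `9225a1` is its Cremona equation. [cite: SilvermanAEC2009, VIII.8] -/
theorem intModel_9225a1 :
    haveI := isGloballyMinimal_9225a1
    integralModelInt (⟨0, 0, 1, 2580, 549326⟩ : WeierstrassCurve ℚ) = ⟨0, 0, 1, 2580, 549326⟩ :=
  haveI := isGloballyMinimal_9225a1
  integralModelInt_eq_of_map_eq _ (map_mk_int 0 0 1 2580 549326)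

/-- **The twin identity ON THE NOSE**: `⟨u,r,s,t⟩ = ⟨1,0,0,-1/2⟩` carries the minimal twin `W₁` to the tree's
twist model `9225a1^(-59) = [0, 0, 0, 59²·2580, -59³·2197305/4]` (`b₂ = 0`, `b₄ = 5160`, `b₆ = 2197305`).
[cite: SilvermanAEC2009, X.5 Cor. 5.4 and III.1 Table 3.1] -/
theorem smul_9225a1d59 : (⟨1, 0, 0, -1/2⟩ : VariableChange ℚ) • (⟨0, 0, 1, 8980980, -112820075899⟩ : WeierstrassCurve ℚ) =
    (⟨0, 0, 1, 2580, 549326⟩ : WeierstrassCurve ℚ).quadraticTwist (((-59 : ℤ)) : ℚ) := by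
  ext
  · simp only [variableChange_a₁, quadraticTwist_a₁]; norm_num
  · simp only [variableChange_a₂, quadraticTwist_a₂, WeierstrassCurve.b₂]; norm_num
  · simp only [variableChange_a₃, quadraticTwist_a₃]; norm_num
  · simp only [variableChange_a₄, quadraticTwist_a₄, WeierstrassCurve.b₄]; norm_num
  · simp only [variableChange_a₆, quadraticTwist_a₆, WeierstrassCurve.b₆]; norm_num

/-- The inverse change: `⟨1,0,0,1/2⟩` carries the twist model to the minimal twin `W₁`. [cite: SilvermanAEC2009, X.5 Cor. 5.4 and III.1 Table 3.1] -/
theorem smul_quadraticTwist_9225a1 : (⟨1, 0, 0, 1/2⟩ : VariableChange ℚ) • (⟨0, 0, 1, 2580, 549326⟩ : WeierstrassCurve ℚ).quadraticTwist (((-59 : ℤ)) : ℚ) =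
    (⟨0, 0, 1, 8980980, -112820075899⟩ : WeierstrassCurve ℚ) := by
  ext
  · simp only [variableChange_a₁, quadraticTwist_a₁]; norm_num
  · simp only [variableChange_a₂, quadraticTwist_a₂, quadraticTwist_a₁, WeierstrassCurve.b₂]; norm_num
  · simp only [variableChange_a₃, quadraticTwist_a₃, quadraticTwist_a₁]; norm_num
  · simp only [variableChange_a₄, quadraticTwist_a₄, quadraticTwist_a₃, quadraticTwist_a₂, quadraticTwist_a₁,
      WeierstrassCurve.b₂, WeierstrassCurve.b₄]; norm_num
  · simp only [variableChange_a₆, quadraticTwist_a₆, quadraticTwist_a₄, quadraticTwist_a₃, quadraticTwist_a₂,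
      quadraticTwist_a₁, WeierstrassCurve.b₂, WeierstrassCurve.b₄, WeierstrassCurve.b₆]; norm_num

/-- The twin identity in the crux's shape: `∃ C, C • W₁ = 9225a1^(d_K)`. [cite: SilvermanAEC2009, X.5 Cor. 5.4] -/
theorem exists_smul_9225a1d59 : ∃ C : VariableChange ℚ, C • (⟨0, 0, 1, 8980980, -112820075899⟩ : WeierstrassCurve ℚ) =
    (⟨0, 0, 1, 2580, 549326⟩ : WeierstrassCurve ℚ).quadraticTwist (((-59 : ℤ)) : ℚ) :=
  ⟨_, smul_9225a1d59⟩

/-! ## §2 The primes of `N(9225a1)` and the frame `(d_K, d_F) = (-59, 181)` -/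

/-- A prime dividing the conductor of `9225a1` is `3`, `5` or `41` (good reduction off `Δ = -3³·5²·41⁷`).
[cite: SilvermanAEC2009, VII.5 Prop. 5.1 (a)] -/
theorem prime_dvd_conductorNorm_9225a1 {ℓ : ℕ} (hℓ : ℓ.Prime)
    (h : haveI := isElliptic_9225a1; ℓ ∣ (⟨0, 0, 1, 2580, 549326⟩ : WeierstrassCurve ℚ).conductorNorm ℤ) :
    ℓ = 3 ∨ ℓ = 5 ∨ ℓ = 41 := by
  haveI := isElliptic_9225a1; haveI := isGloballyMinimal_9225a1; haveI := Fact.mk hℓ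
  by_contra hne
  push Not at hne
  refine not_dvd_conductorNorm_of_hasGoodReductionAtPrime (⟨0, 0, 1, 2580, 549326⟩ : WeierstrassCurve ℚ) ?_ h
  refine hasGoodReductionAtPrime_of_not_dvd (⟨0, 0, 1, 2580, 549326⟩ : WeierstrassCurve ℚ) ℓ ?_
  rw [minimalDiscriminantInt_eq intModel_9225a1]
  have hΔ : (⟨0, 0, 1, 2580, 549326⟩ : WeierstrassCurve ℤ).Δ = -(3 ^ 3 * 5 ^ 2 * 41 ^ 7) := by
    simp only [WeierstrassCurve.Δ, WeierstrassCurve.b₂, WeierstrassCurve.b₄, WeierstrassCurve.b₆,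
      WeierstrassCurve.b₈]; norm_num
  rw [hΔ, Int.dvd_neg]
  intro hd
  have hd' : ℓ ∣ 3 ^ 3 * 5 ^ 2 * 41 ^ 7 := by exact_mod_cast hd
  rcases (Nat.Prime.dvd_mul hℓ).mp hd' with h35 | h41
  · rcases (Nat.Prime.dvd_mul hℓ).mp h35 with h3 | h5
    · exact hne.1 ((Nat.prime_dvd_prime_iff_eq hℓ Nat.prime_three).mp (hℓ.dvd_of_dvd_pow h3))
    · exact hne.2.1 ((Nat.prime_dvd_prime_iff_eq hℓ Nat.prime_five).mp (hℓ.dvd_of_dvd_pow h5))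
  · exact hne.2.2 ((Nat.prime_dvd_prime_iff_eq hℓ (by norm_num)).mp (hℓ.dvd_of_dvd_pow h41))

/-- `-59` is square-free. [folklore] -/
theorem squarefree_neg59 : Squarefree ((-59) : ℤ) := by
  rw [← Int.squarefree_natAbs, show ((-59) : ℤ).natAbs = 59 by norm_num]
  exact (by norm_num : Nat.Prime 59).squarefree

/-- **`(d_K, d_F) = (-59, 181)` is BCS-ADMISSIBLE for `(9225a1, 7)`**: `-59 < 0` square-free `≡ 1 (4)`, `≠ -3`;
`3, 5, 41` (the primes of `N`) and `7` split in `ℚ(√-59)` (`-59 ≡ 1², 1², 8², 2²`); `181 > 1` prime `≡ 1 (4)`;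
`7` inert in `ℚ(√181)` (`181 ≡ 6 (7)`, a non-residue); `181` splits in `ℚ(√-59)` (`-59 ≡ 22² (181)`);
`3, 5 ≢ -1 (7)` split in `ℚ(√181)` (`181 ≡ 1`), `41 ≡ -1 (7)` is inert in `ℚ(√181)` (`181 ≡ 17 (41)`, a
non-residue); `p = 7 ≠ 5`. [cite: BurungaleCastellaSkinner2025, §1.2 (disc)/(Heeg)/(spl), Prop. 5.2.1 (i)–(vi)] -/
theorem bcsAdmissiblePair_9225a1 :
    haveI := isElliptic_9225a1; haveI := isGloballyMinimal_9225a1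
    BCSAdmissiblePair (⟨0, 0, 1, 2580, 549326⟩ : WeierstrassCurve ℚ) 7 (-59) 181 := by
  haveI := isElliptic_9225a1; haveI := isGloballyMinimal_9225a1
  have h181p : Nat.Prime 181 := by norm_num
  have h181 : Squarefree ((181) : ℤ) := by
    rw [← Int.squarefree_natAbs, show ((181) : ℤ).natAbs = 181 by norm_num]
    exact h181p.squarefree
  have hK3 : SplitsInQuadField (-59) 3 :=
    ⟨by decide, fun h => absurd h (by decide), fun _ => ⟨1, by decide⟩⟩
  have hK5 : SplitsInQuadField (-59) 5 :=
    ⟨by decide, fun h => absurd h (by decide), fun _ => ⟨1, by decide⟩⟩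
  have hK41 : SplitsInQuadField (-59) 41 :=
    ⟨by decide, fun h => absurd h (by decide), fun _ => ⟨8, by decide⟩⟩
  have hK7 : SplitsInQuadField (-59) 7 :=
    ⟨by decide, fun h => absurd h (by decide), fun _ => ⟨2, by decide⟩⟩
  have hK181 : SplitsInQuadField (-59) 181 :=
    ⟨by decide, fun h => absurd h (by decide), fun _ => ⟨22, by decide⟩⟩
  have hF3 : SplitsInQuadField 181 3 :=
    ⟨by decide, fun h => absurd h (by decide), fun _ => ⟨1, by decide⟩⟩
  have hF5 : SplitsInQuadField 181 5 :=
    ⟨by decide, fun h => absurd h (by decide), fun _ => ⟨1, by decide⟩⟩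
  have hF41 : InertInQuadField 181 41 :=
    ⟨by decide, fun h => absurd h (by decide), fun _ => by decide⟩
  have hF7 : InertInQuadField 181 7 :=
    ⟨by decide, fun h => absurd h (by decide), fun _ => by decide⟩
  refine ⟨⟨by norm_num, squarefree_neg59, by decide, by decide⟩, ?_, hK7, ⟨by norm_num, h181, by decide⟩, hF7, ?_, ?_,
    fun h => absurd h (by decide)⟩
  · intro ℓ hℓ hℓN
    rcases prime_dvd_conductorNorm_9225a1 hℓ hℓN with rfl | rfl | rfl
    exacts [hK3, hK5, hK41]
  · intro ℓ hℓ hℓd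
    have h' : ℓ ∣ 181 := by exact_mod_cast Int.natAbs_dvd_natAbs.mpr hℓd
    have : ℓ = 181 := (Nat.prime_dvd_prime_iff_eq hℓ h181p).mp h'
    subst this; exact hK181
  · intro ℓ hℓ hℓN
    rcases prime_dvd_conductorNorm_9225a1 hℓ hℓN with rfl | rfl | rfl
    · exact ⟨fun h => absurd h (by decide), fun _ => hF3⟩
    · exact ⟨fun h => absurd h (by decide), fun _ => hF5⟩
    · exact ⟨fun _ => hF41, fun h => absurd (by decide) h⟩

/-! ## §3 The Heegner field `ℚ(√-59)` for `9225a1` -/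

section HeegnerField

variable {K : Type} [Field K] [NumberField K]

/-- `3` splits in a quadratic field of discriminant `-59` (`-59 ≡ 1² (mod 3)`). [cite: Marcus1977, Ch. 3 Thm. 25] -/
theorem three_splits_neg59 (hK2 : Module.finrank ℚ K = 2) (hdK : NumberField.discr K = -59) :
    ((Ideal.span {((3 : ℕ) : ℤ)}).primesOver (𝓞 K)).ncard = 2 :=
  Summit.BirchSwinnertonDyer.Rank1Residual.X9.PrintCert.Record.ncard_primesOver_eq_two_of_witness hK2 Nat.prime_three (by decide) (s := 1)
    (by rw [hdK]; decide) (by rw [hdK]; decide)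

/-- `5` splits in a quadratic field of discriminant `-59` (`-59 ≡ 1² (mod 5)`). [cite: Marcus1977, Ch. 3 Thm. 25] -/
theorem five_splits_neg59 (hK2 : Module.finrank ℚ K = 2) (hdK : NumberField.discr K = -59) :
    ((Ideal.span {((5 : ℕ) : ℤ)}).primesOver (𝓞 K)).ncard = 2 :=
  Summit.BirchSwinnertonDyer.Rank1Residual.X9.PrintCert.Record.ncard_primesOver_eq_two_of_witness hK2 Nat.prime_five (by decide) (s := 1)
    (by rw [hdK]; decide) (by rw [hdK]; decide)

/-- `41` splits in a quadratic field of discriminant `-59` (`-59 ≡ 8² (mod 41)`). [cite: Marcus1977, Ch. 3 Thm. 25] -/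
theorem fortyone_splits_neg59 (hK2 : Module.finrank ℚ K = 2) (hdK : NumberField.discr K = -59) :
    ((Ideal.span {((41 : ℕ) : ℤ)}).primesOver (𝓞 K)).ncard = 2 :=
  Summit.BirchSwinnertonDyer.Rank1Residual.X9.PrintCert.Record.ncard_primesOver_eq_two_of_witness hK2 (by norm_num) (by decide) (s := 8)
    (by rw [hdK]; decide) (by rw [hdK]; decide)

/-- **Heegner hypothesis of `ℚ(√-59)` for the level `9225 = 3²·5²·41`.** [cite: GrossLMS1991, §1] -/
theorem satisfiesHeegnerHypothesis_9225 (hK2 : Module.finrank ℚ K = 2) (hdK : NumberField.discr K = -59) :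
    SatisfiesHeegnerHypothesis 9225 K := by
  intro ℓ hℓ hℓN
  have hℓN' : ℓ ∣ 3 ^ 2 * 5 ^ 2 * 41 := by norm_num at hℓN ⊢; exact hℓN
  rcases (Nat.Prime.dvd_mul hℓ).mp hℓN' with h35 | h41
  · rcases (Nat.Prime.dvd_mul hℓ).mp h35 with h3 | h5
    · obtain rfl := (Nat.prime_dvd_prime_iff_eq hℓ Nat.prime_three).mp (hℓ.dvd_of_dvd_pow h3)
      exact three_splits_neg59 hK2 hdK
    · obtain rfl := (Nat.prime_dvd_prime_iff_eq hℓ Nat.prime_five).mp (hℓ.dvd_of_dvd_pow h5)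
      exact five_splits_neg59 hK2 hdK
  · obtain rfl := (Nat.prime_dvd_prime_iff_eq hℓ (by norm_num)).mp h41
    exact fortyone_splits_neg59 hK2 hdK

/-- **Heegner hypothesis of `ℚ(√-59)` for the conductor of `9225a1`** (its primes are `3, 5, 41`). [cite: GrossLMS1991, §1] -/
theorem satisfiesHeegnerHypothesis_conductorNorm_9225a1 (hK2 : Module.finrank ℚ K = 2)
    (hdK : NumberField.discr K = -59) :
    haveI := isElliptic_9225a1
    SatisfiesHeegnerHypothesis ((⟨0, 0, 1, 2580, 549326⟩ : WeierstrassCurve ℚ).conductorNorm ℤ) K := by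
  intro ℓ hℓ hℓN
  rcases prime_dvd_conductorNorm_9225a1 hℓ hℓN with rfl | rfl | rfl
  exacts [three_splits_neg59 hK2 hdK, five_splits_neg59 hK2 hdK, fortyone_splits_neg59 hK2 hdK]

end HeegnerField

/-! ## §4 The rung: the crux body at `(9225a1, 7)` -/

/-- The rung's statement IS the instance of the crux: `TrivialTwinSupplyX9` specialises VERBATIM to the
crux body at `(W, p) = (9225a1, 7)` (bound variables renamed). [cite: BurungaleCastellaSkinner2025, §1.2 and Prop. 5.2.1] -/
theorem rung_isInstance_9225a1_7 (h : TrivialTwinSupplyX9) :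
    haveI := isElliptic_9225a1; haveI := isGloballyMinimal_9225a1; haveI : Fact (Nat.Prime 7) := ⟨by norm_num⟩
    ClassX9 (⟨0, 0, 1, 2580, 549326⟩ : WeierstrassCurve ℚ) 7 → ¬ 7 ∣ (⟨0, 0, 1, 2580, 549326⟩ : WeierstrassCurve ℚ).tamagawaProduct → ∃ dK dF : ℤ, BCSAdmissiblePair (⟨0, 0, 1, 2580, 549326⟩ : WeierstrassCurve ℚ) 7 dK dF ∧
      ∃ (V₁ : WeierstrassCurve ℚ) (_ : V₁.IsElliptic) (_ : V₁.IsGloballyMinimal),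
        (∃ C : WeierstrassCurve.VariableChange ℚ, C • V₁ = (⟨0, 0, 1, 2580, 549326⟩ : WeierstrassCurve ℚ).quadraticTwist (dK : ℚ)) ∧
        ((V₁.analyticRank = 0 ∧ ¬ 7 ∣ V₁.shaOrder ∧ ¬ 7 ∣ V₁.tamagawaProduct ∧ ¬ 7 ∣ V₁.torsionOrder ∧
            ∃ q : ℚ, V₁.leadingLCoeff / (V₁.realPeriodRat : ℂ) = (q : ℂ) ∧ padicValRat 7 q = 0) ∨
          ∃ dK' dF' : ℤ, BCSAdmissiblePair V₁ 7 dK' dF' ∧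
            ∃ (V₂ : WeierstrassCurve ℚ) (_ : V₂.IsElliptic) (_ : V₂.IsGloballyMinimal),
              (∃ C : WeierstrassCurve.VariableChange ℚ, C • V₂ = V₁.quadraticTwist (dK' : ℚ)) ∧
              (V₂.analyticRank = 0 ∧ ¬ 7 ∣ V₂.shaOrder ∧ ¬ 7 ∣ V₂.tamagawaProduct ∧ ¬ 7 ∣ V₂.torsionOrder ∧
                ∃ q : ℚ, V₂.leadingLCoeff / (V₂.realPeriodRat : ℂ) = (q : ℂ) ∧ padicValRat 7 q = 0)) :=
  @h (⟨0, 0, 1, 2580, 549326⟩ : WeierstrassCurve ℚ) isElliptic_9225a1 isGloballyMinimal_9225a1 7 ⟨by norm_num⟩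

/-- **THE RUNG (second instance, image class `7Ns`).** The crux body at `(9225a1, 7)`, witnessed by the frame
`(d_K, d_F) = (-59, 181)` and the twin `W₁ = 9225a1^(-59)` (first disjunct: the twin is BSD₇-trivial in every
factor except `#Ш`, and `7 ∤ #Ш(W₁)` by Kolyvagin + Matar–Nekovář transported along `W₁ ⊗ K ≅ 9225a1 ⊗ K`,
`K = ℚ(√-59)`). Displayed binders: the two PUBLISHED named facts (`kolyvagin`, Matar–Nekovář Thm. 0.3) and the
ENGINE data of the pair (`r_an(W₁) = 0`, `L(W₁,1)/Ω(W₁) = 4`, the Heegner point `y_K = -2·(-6, 730)` of infinite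
order with `7 ∤ [E(K) : ℤ y_K]`; preregistered kit PARI job j298937 VERDICT PASS, memo
`Cruxes/TrivialTwinSupplyX9/Lines/rung_9225a1_7.md`). BSD is NOT proved.
[cite: MatarNekovar2019, Thm. 0.3 (p. 456)] [cite: KolyvaginEulerSystems1990, Thm. A]
[cite: GrossLMS1991, §2 Prop. 2.1 (2), Prop. 2.3] [cite: JetchevSkinnerWan2017, §7.3.1 (eq:tamK)]
[cite: BurungaleCastellaSkinner2025, §1.2, Prop. 5.2.1] -/
theorem rung_9225a1_7 {K : Type} [Field K] [NumberField K] (hK : IsImaginaryQuadratic K)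
    (hdK : NumberField.discr K = -59) (hKo : kolyvagin 9225 (⟨0, 0, 1, 2580, 549326⟩ : WeierstrassCurve ℚ) K)
    (hMN : MatarNekovar2019.thm03_padicValNat_card_sha_le_of_irreducible 9225 (⟨0, 0, 1, 2580, 549326⟩ : WeierstrassCurve ℚ) K)
    {P : ((⟨0, 0, 1, 2580, 549326⟩ : WeierstrassCurve ℚ).baseChange K).toAffine.Point} (hP : IsHeegnerPoint 9225 (⟨0, 0, 1, 2580, 549326⟩ : WeierstrassCurve ℚ) K P) (hnt : ¬ IsOfFinAddOrder P)
    (hI : ¬ 7 ∣ (AddSubgroup.zmultiples P).index) (hr₁ : (⟨0, 0, 1, 8980980, -112820075899⟩ : WeierstrassCurve ℚ).analyticRank = 0)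
    (hL₁ : (⟨0, 0, 1, 8980980, -112820075899⟩ : WeierstrassCurve ℚ).leadingLCoeff / ((⟨0, 0, 1, 8980980, -112820075899⟩ : WeierstrassCurve ℚ).realPeriodRat : ℂ) = ((4 : ℚ) : ℂ)) :
    haveI := isElliptic_9225a1; haveI := isGloballyMinimal_9225a1; haveI : Fact (Nat.Prime 7) := ⟨by norm_num⟩
    ClassX9 (⟨0, 0, 1, 2580, 549326⟩ : WeierstrassCurve ℚ) 7 → ¬ 7 ∣ (⟨0, 0, 1, 2580, 549326⟩ : WeierstrassCurve ℚ).tamagawaProduct → ∃ dK dF : ℤ, BCSAdmissiblePair (⟨0, 0, 1, 2580, 549326⟩ : WeierstrassCurve ℚ) 7 dK dF ∧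
      ∃ (V₁ : WeierstrassCurve ℚ) (_ : V₁.IsElliptic) (_ : V₁.IsGloballyMinimal),
        (∃ C : WeierstrassCurve.VariableChange ℚ, C • V₁ = (⟨0, 0, 1, 2580, 549326⟩ : WeierstrassCurve ℚ).quadraticTwist (dK : ℚ)) ∧
        ((V₁.analyticRank = 0 ∧ ¬ 7 ∣ V₁.shaOrder ∧ ¬ 7 ∣ V₁.tamagawaProduct ∧ ¬ 7 ∣ V₁.torsionOrder ∧
            ∃ q : ℚ, V₁.leadingLCoeff / (V₁.realPeriodRat : ℂ) = (q : ℂ) ∧ padicValRat 7 q = 0) ∨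
          ∃ dK' dF' : ℤ, BCSAdmissiblePair V₁ 7 dK' dF' ∧
            ∃ (V₂ : WeierstrassCurve ℚ) (_ : V₂.IsElliptic) (_ : V₂.IsGloballyMinimal),
              (∃ C : WeierstrassCurve.VariableChange ℚ, C • V₂ = V₁.quadraticTwist (dK' : ℚ)) ∧
              (V₂.analyticRank = 0 ∧ ¬ 7 ∣ V₂.shaOrder ∧ ¬ 7 ∣ V₂.tamagawaProduct ∧ ¬ 7 ∣ V₂.torsionOrder ∧
                ∃ q : ℚ, V₂.leadingLCoeff / (V₂.realPeriodRat : ℂ) = (q : ℂ) ∧ padicValRat 7 q = 0)) := by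
  haveI := isElliptic_9225a1; haveI := isGloballyMinimal_9225a1
  haveI := isElliptic_9225a1d59; haveI := isGloballyMinimal_9225a1d59
  haveI i7 : Fact (Nat.Prime 7) := ⟨by norm_num⟩
  haveI : NeZero (9225 : ℕ) := ⟨by norm_num⟩
  haveI iT : ((⟨0, 0, 1, 2580, 549326⟩ : WeierstrassCurve ℚ).quadraticTwist (((-59 : ℤ)) : ℚ)).IsElliptic :=
    isElliptic_quadraticTwist _ (by norm_num)
  intro hX9 hTam
  have hirr : (⟨0, 0, 1, 2580, 549326⟩ : WeierstrassCurve ℚ).HasIrreducibleModPGaloisRep 7 := hX9.2.2.2.2.1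
  -- `Ш(W₁)`: Kolyvagin + Matar–Nekovář over `K`, transported to the twist model, then to the minimal twin
  have hshaT : ¬ 7 ∣ ((⟨0, 0, 1, 2580, 549326⟩ : WeierstrassCurve ℚ).quadraticTwist (((-59 : ℤ)) : ℚ)).shaOrder :=
    (shaFinite_and_not_dvd_shaOrder_twist_of_mn03 (⟨0, 0, 1, 2580, 549326⟩ : WeierstrassCurve ℚ) hK hdK (by norm_num) (by norm_num) (by norm_num)
      (satisfiesHeegnerHypothesis_9225 hK.1 hdK) hKo hMN hP hnt (by norm_num) hirr hI
      ((⟨0, 0, 1, 2580, 549326⟩ : WeierstrassCurve ℚ).quadraticTwist (((-59 : ℤ)) : ℚ)) rfl).2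
  have hsv : ((⟨1, 0, 0, -1/2⟩ : VariableChange ℚ) • (⟨0, 0, 1, 8980980, -112820075899⟩ : WeierstrassCurve ℚ)).shaOrder =
      (⟨0, 0, 1, 8980980, -112820075899⟩ : WeierstrassCurve ℚ).shaOrder :=
    shaOrder_variableChange_holds _ _
  have hsha : ¬ 7 ∣ (⟨0, 0, 1, 8980980, -112820075899⟩ : WeierstrassCurve ℚ).shaOrder := by
    rw [← hsv, smul_9225a1d59]; exact hshaT
  -- `∏ c_ℓ(W₁)`: Jetchev–Skinner–Wan (eq:tamK), all bad primes of `9225a1` split in `K`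
  have htamv : padicValNat 7 (⟨0, 0, 1, 8980980, -112820075899⟩ : WeierstrassCurve ℚ).tamagawaProduct = padicValNat 7 (⟨0, 0, 1, 2580, 549326⟩ : WeierstrassCurve ℚ).tamagawaProduct :=
    Castella2018.TamagawaQuadratic.padicValNat_tamagawaProduct_quadraticTwist_eq (⟨0, 0, 1, 2580, 549326⟩ : WeierstrassCurve ℚ) 7 K (⟨0, 0, 1, 8980980, -112820075899⟩ : WeierstrassCurve ℚ) (by norm_num) hK.1
      (fun ℓ _ hℓN hns => absurd (satisfiesHeegnerHypothesis_conductorNorm_9225a1 hK.1 hdK ℓ Fact.out hℓN) hns)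
      ⟨⟨1, 0, 0, 1/2⟩, by rw [hdK]; exact smul_quadraticTwist_9225a1⟩
  have htam : ¬ 7 ∣ (⟨0, 0, 1, 8980980, -112820075899⟩ : WeierstrassCurve ℚ).tamagawaProduct :=
    not_dvd_of_padicValNat_eq_zero i7.out (⟨0, 0, 1, 8980980, -112820075899⟩ : WeierstrassCurve ℚ).tamagawaProduct_pos'
      (htamv.trans (padicValNat.eq_zero_of_not_dvd hTam))
  -- `#W₁(ℚ)_tors`: `ρ̄_{W₁,7} ≅ ρ̄_{9225a1,7} ⊗ χ` is irreducible
  have hX9₁ : ClassX9 (⟨0, 0, 1, 8980980, -112820075899⟩ : WeierstrassCurve ℚ) 7 :=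
    Summit.BirchSwinnertonDyer.Rank1Residual.X9.classX9_of_smul_eq_quadraticTwist (⟨0, 0, 1, 2580, 549326⟩ : WeierstrassCurve ℚ) (⟨0, 0, 1, 8980980, -112820075899⟩ : WeierstrassCurve ℚ) 7 hX9 squarefree_neg59
      smul_9225a1d59 (by decide)
  have htors : ¬ 7 ∣ (⟨0, 0, 1, 8980980, -112820075899⟩ : WeierstrassCurve ℚ).torsionOrder :=
    not_dvd_of_padicValNat_eq_zero i7.out (⟨0, 0, 1, 8980980, -112820075899⟩ : WeierstrassCurve ℚ).torsionOrder_pos_holds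
      (Rank1Residual.padicValNat_torsionOrder_eq_zero_of_irreducible (⟨0, 0, 1, 8980980, -112820075899⟩ : WeierstrassCurve ℚ) 7 hX9₁.2.2.2.2.1)
  have h4 : padicValRat 7 (4 : ℚ) = 0 := by
    rw [show ((4 : ℚ)) = ((4 : ℕ) : ℚ) by norm_num, padicValRat.of_nat, Nat.cast_eq_zero]
    exact padicValNat.eq_zero_of_not_dvd (by norm_num)
  exact ⟨-59, 181, bcsAdmissiblePair_9225a1, (⟨0, 0, 1, 8980980, -112820075899⟩ : WeierstrassCurve ℚ), isElliptic_9225a1d59, isGloballyMinimal_9225a1d59, exists_smul_9225a1d59,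
    Or.inl ⟨hr₁, hsha, htam, htors, 4, hL₁, h4⟩⟩

end Summit.BirchSwinnertonDyer.BirchSwinnertonDyer.Theorems.TwinTransportX9Rung

end
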